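import Mathlib
import Summits.SmoothPoincare4.SmoothPoincare4.Theorems.SullivanDualTameOrBrodyR4PencilDefs
import Literature.Geometry.Symplectic.JHolomorphicMap

/-!
# The zeroth-order coefficient of the frame-conjugated linearised Cauchy–Riemann operator

Registered helper `helper_linearisationTriangular` of crux `TameOrBrodyR4`
(stmt-SmoothPoincare4-7826, route `SullivanDual`, line `Sketch`).

Let `u₀ : ℂ → ℝ⁴` be a smooth flat-`J`-holomorphic map (`∂_y u₀ = J(u₀) ∂ₓ u₀`, equivalently
`∂ₓ u₀ + J(u₀) ∂_y u₀ = 0`) and `Ψ ξ : ℂ² → ℝ⁴` a smooth frame along it whose first column is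
`du₀(ξ)` and which is standard (`(y₁, y₂) ↦ du₀(ξ) y₁ + eQ y₂`) far out, where moreover `u₀` lies
in the region where `J` is the constant standard structure. Writing nearby maps as
`u = u₀ + Ψ w̃`, the linearisation at `w̃ = 0` of `u ↦ ∂ₓ u + J(u) ∂_y u`, conjugated by `Ψ`, is
`w̃ ↦ 2 ∂̄ w̃ + S(ξ) w̃` with the zeroth-order coefficient
`S ξ = Ψinv ξ ∘ (∂ₓΨ(ξ) + J(u₀ ξ) ∘ ∂_yΨ(ξ) + (A ↦ A (∂_y u₀ ξ)) ∘ DJ(u₀ ξ) ∘ Ψ ξ)`.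

We prove: `S` is `C^∞`; `S ξ` kills the tangent column `(y₁, 0)` (upper triangularity:
infinitesimal reparametrisations of `u₀` solve the linearised equation — the value on the tangent
column is the `y₁`-derivative of the identically vanishing map `∂ₓ u₀ + J(u₀) ∂_y u₀`, by the
symmetry of second derivatives and the Leibniz/chain rule); and `S ξ = 0` far out (there `J` is
locally constant near `u₀ ξ`, so `DJ(u₀ ξ) = 0`, and the second column `eQ y₂` of the frame does
not depend on `ξ`). Pure calculus.
-/

-- the registered namespace `Summit.SmoothPoincare4.SmoothPoincare4.…` repeats a component
set_option linter.dupNamespace false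

noncomputable section

open scoped ContDiff Topology
open Filter Set Literature.Geometry.Symplectic

namespace Summit.SmoothPoincare4.SmoothPoincare4.Cruxes.TameOrBrodyR4.Sketch

/-- Local notation for the model space `ℝ⁴ = EuclideanSpace ℝ (Fin 4)`. -/
local notation "E4" => EuclideanSpace ℝ (Fin 4)

namespace LinearisationTriangular

variable {X Y : Type*} [NormedAddCommGroup X] [NormedSpace ℝ X] [NormedAddCommGroup Y]
  [NormedSpace ℝ Y]

/-- Evaluating the derivative of a CLM-valued map at a fixed vector: `(Dc(ξ) v) y` is the
derivative in direction `v` of `ξ' ↦ c ξ' y`. -/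
theorem fderiv_apply_const {c : ℂ → X →L[ℝ] Y} {ξ : ℂ} (hc : DifferentiableAt ℝ c ξ) (y : X)
    (v : ℂ) : fderiv ℝ c ξ v y = fderiv ℝ (fun ξ' => c ξ' y) ξ v := by
  have h : HasFDerivAt (fun ξ' => c ξ' y)
      ((c ξ).comp (0 : ℂ →L[ℝ] X) + (fderiv ℝ c ξ).flip y) ξ :=
    hc.hasFDerivAt.clm_apply (hasFDerivAt_const y ξ)
  rw [h.fderiv]
  simp

/-- Symmetry of second directional derivatives of a `C^∞` map on `ℂ`. -/
theorem fderiv_fderiv_symm {u : ℂ → Y} (hu : ContDiff ℝ ∞ u) (ξ a b : ℂ) :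
    fderiv ℝ (fun ξ' => fderiv ℝ u ξ' a) ξ b = fderiv ℝ (fun ξ' => fderiv ℝ u ξ' b) ξ a := by
  have hd : DifferentiableAt ℝ (fderiv ℝ u) ξ :=
    (contDiff_infty_iff_fderiv.mp hu).2.differentiable (by simp) ξ
  rw [← fderiv_apply_const hd a b, ← fderiv_apply_const hd b a]
  exact (hu.contDiffAt.isSymmSndFDerivAt (by
    rw [minSmoothness_of_isRCLikeNormedField]
    exact WithTop.coe_le_coe.2 le_top)).eq b a

/-! The inner (unconjugated) zeroth-order coefficient is
`T ξ = ∂ₓΨ(ξ) + J(u₀ ξ) ∘ ∂_yΨ(ξ) + (A ↦ A (∂_y u₀ ξ)) ∘ DJ(u₀ ξ) ∘ Ψ ξ`; it is written out in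
full in every statement below (no auxiliary definition). -/

/-- Pointwise formula for the inner coefficient `T ξ`. -/
theorem innerCoeff_apply (J : E4 → E4 →L[ℝ] E4) (u₀ : ℂ → E4) (Ψ : ℂ → (ℂ × ℂ) →L[ℝ] E4)
    (ξ : ℂ) (y : ℂ × ℂ) :
    (fderiv ℝ Ψ ξ (1 : ℂ) + (J (u₀ ξ)).comp (fderiv ℝ Ψ ξ Complex.I) +
      (ContinuousLinearMap.apply ℝ E4 (fderiv ℝ u₀ ξ Complex.I)).comp
        ((fderiv ℝ J (u₀ ξ)).comp (Ψ ξ))) y =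
    fderiv ℝ Ψ ξ (1 : ℂ) y + J (u₀ ξ) (fderiv ℝ Ψ ξ Complex.I y) +
      fderiv ℝ J (u₀ ξ) (Ψ ξ y) (fderiv ℝ u₀ ξ Complex.I) := by
  simp

/-- Smoothness of the inner coefficient `T`. -/
theorem contDiff_innerCoeff (J : E4 → E4 →L[ℝ] E4) (hJs : ContDiff ℝ ∞ J) (u₀ : ℂ → E4)
    (hu₀s : ContDiff ℝ ∞ u₀) (Ψ : ℂ → (ℂ × ℂ) →L[ℝ] E4) (hΨs : ContDiff ℝ ∞ Ψ) :
    ContDiff ℝ ∞ (fun ξ : ℂ => fderiv ℝ Ψ ξ (1 : ℂ) + (J (u₀ ξ)).comp (fderiv ℝ Ψ ξ Complex.I) +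
      (ContinuousLinearMap.apply ℝ E4 (fderiv ℝ u₀ ξ Complex.I)).comp
        ((fderiv ℝ J (u₀ ξ)).comp (Ψ ξ))) := by
  have hDΨ : ContDiff ℝ ∞ (fderiv ℝ Ψ) := (contDiff_infty_iff_fderiv.mp hΨs).2
  have hDu₀ : ContDiff ℝ ∞ (fderiv ℝ u₀) := (contDiff_infty_iff_fderiv.mp hu₀s).2
  have hDJ : ContDiff ℝ ∞ (fderiv ℝ J) := (contDiff_infty_iff_fderiv.mp hJs).2
  have hA : ContDiff ℝ ∞ (fun ξ => fderiv ℝ Ψ ξ (1 : ℂ)) := hDΨ.clm_apply contDiff_const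
  have hB : ContDiff ℝ ∞ (fun ξ => (J (u₀ ξ)).comp (fderiv ℝ Ψ ξ Complex.I)) :=
    (hJs.comp hu₀s).clm_comp (hDΨ.clm_apply contDiff_const)
  have hdy : ContDiff ℝ ∞ (fun ξ => fderiv ℝ u₀ ξ Complex.I) := hDu₀.clm_apply contDiff_const
  -- (the codomain `F` is given explicitly: instance search does not see through the notation
  -- `E4 →L[ℝ] (E4 →L[ℝ] E4) →L[ℝ] E4`)
  have hL : ContDiff ℝ ∞ (fun v : E4 => ContinuousLinearMap.apply ℝ E4 v) :=
    ContinuousLinearMap.contDiff (𝕜 := ℝ) (E := E4) (F := (E4 →L[ℝ] E4) →L[ℝ] E4)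
      (ContinuousLinearMap.apply ℝ E4)
  have hev : ContDiff ℝ ∞ (fun ξ => ContinuousLinearMap.apply ℝ E4 (fderiv ℝ u₀ ξ Complex.I)) :=
    hL.comp hdy
  have hC : ContDiff ℝ ∞ (fun ξ => (ContinuousLinearMap.apply ℝ E4 (fderiv ℝ u₀ ξ Complex.I)).comp
      ((fderiv ℝ J (u₀ ξ)).comp (Ψ ξ))) :=
    hev.clm_comp ((hDJ.comp hu₀s).clm_comp hΨs)
  exact (hA.add hB).add hC

/-- **Upper triangularity.** The inner coefficient kills the tangent column: its value on
`(y₁, 0)` is the `y₁`-derivative of the identically vanishing map `∂ₓ u₀ + J(u₀) ∂_y u₀`. -/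
theorem innerCoeff_apply_tangent (J : E4 → E4 →L[ℝ] E4) (hJs : ContDiff ℝ ∞ J)
    (hJ2 : ∀ x v, J x (J x v) = -v) (u₀ : ℂ → E4) (hu₀s : ContDiff ℝ ∞ u₀)
    (hu₀J : IsJHolomorphicFlat J u₀) (Ψ : ℂ → (ℂ × ℂ) →L[ℝ] E4) (hΨs : ContDiff ℝ ∞ Ψ)
    (hΨt : ∀ ξ (y₁ : ℂ), Ψ ξ (y₁, 0) = fderiv ℝ u₀ ξ y₁) (ξ y₁ : ℂ) :
    (fderiv ℝ Ψ ξ (1 : ℂ) + (J (u₀ ξ)).comp (fderiv ℝ Ψ ξ Complex.I) +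
      (ContinuousLinearMap.apply ℝ E4 (fderiv ℝ u₀ ξ Complex.I)).comp
        ((fderiv ℝ J (u₀ ξ)).comp (Ψ ξ))) (y₁, 0) = 0 := by
  have hDu₀ : ContDiff ℝ ∞ (fderiv ℝ u₀) := (contDiff_infty_iff_fderiv.mp hu₀s).2
  have hdDu₀ : Differentiable ℝ (fderiv ℝ u₀) := hDu₀.differentiable (by simp)
  have hdΨ : Differentiable ℝ Ψ := hΨs.differentiable (by simp)
  have hdu₀ : Differentiable ℝ u₀ := hu₀s.differentiable (by simp)
  have hdJ : Differentiable ℝ J := hJs.differentiable (by simp)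
  -- (1) the derivative of the frame on the tangent column is a second derivative of `u₀`
  have hcol : ∀ v : ℂ, fderiv ℝ Ψ ξ v (y₁, 0) = fderiv ℝ (fun ξ' => fderiv ℝ u₀ ξ' v) ξ y₁ := by
    intro v
    rw [fderiv_apply_const (hdΨ ξ)]
    have : (fun ξ' => Ψ ξ' (y₁, 0)) = fun ξ' => fderiv ℝ u₀ ξ' y₁ := funext fun ξ' => hΨt ξ' y₁
    rw [this]
    exact fderiv_fderiv_symm hu₀s ξ y₁ v
  -- (2) the flat Cauchy–Riemann identity `∂ₓ u₀ + J(u₀) ∂_y u₀ = 0` and its derivative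
  have hflat : (fun ξ' => fderiv ℝ u₀ ξ' 1 + J (u₀ ξ') (fderiv ℝ u₀ ξ' Complex.I)) =
      fun _ => (0 : E4) := by
    funext ξ'
    have h := hu₀J ξ' 1
    rw [mul_one] at h
    rw [h, hJ2, add_neg_cancel]
  have hdx : HasFDerivAt (fun ξ' => fderiv ℝ u₀ ξ' (1 : ℂ))
      (fderiv ℝ (fun ξ' => fderiv ℝ u₀ ξ' (1 : ℂ)) ξ) ξ :=
    ((hdDu₀.clm_apply (differentiable_const _)) ξ).hasFDerivAt
  have hdy : HasFDerivAt (fun ξ' => fderiv ℝ u₀ ξ' Complex.I)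
      (fderiv ℝ (fun ξ' => fderiv ℝ u₀ ξ' Complex.I) ξ) ξ :=
    ((hdDu₀.clm_apply (differentiable_const _)) ξ).hasFDerivAt
  have hJu : HasFDerivAt (fun ξ' => J (u₀ ξ')) ((fderiv ℝ J (u₀ ξ)).comp (fderiv ℝ u₀ ξ)) ξ :=
    (hdJ (u₀ ξ)).hasFDerivAt.comp ξ (hdu₀ ξ).hasFDerivAt
  have hF := hdx.add (hJu.clm_apply hdy)
  have hF' : HasFDerivAt (fun ξ' => fderiv ℝ u₀ ξ' 1 + J (u₀ ξ') (fderiv ℝ u₀ ξ' Complex.I))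
      (0 : ℂ →L[ℝ] E4) ξ := by
    rw [hflat]
    exact hasFDerivAt_const 0 ξ
  have key : fderiv ℝ (fun ξ' => fderiv ℝ u₀ ξ' (1 : ℂ)) ξ y₁ +
      (J (u₀ ξ) (fderiv ℝ (fun ξ' => fderiv ℝ u₀ ξ' Complex.I) ξ y₁) +
        fderiv ℝ J (u₀ ξ) (fderiv ℝ u₀ ξ y₁) (fderiv ℝ u₀ ξ Complex.I)) = 0 := by
    have := DFunLike.congr_fun (hF.unique hF') y₁
    simpa using this
  -- (3) conclude
  rw [innerCoeff_apply, hcol 1, hcol Complex.I, hΨt ξ y₁, add_assoc]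
  exact key

/-- **Vanishing far out.** If, near `ξ`, the frame is `(y₁, y₂) ↦ du₀ y₁ + eQ y₂` and `J` is
locally constant near `u₀ ξ`, then the inner coefficient vanishes at `ξ`. -/
theorem innerCoeff_eq_zero_of (J : E4 → E4 →L[ℝ] E4) (hJs : ContDiff ℝ ∞ J)
    (hJ2 : ∀ x v, J x (J x v) = -v) (u₀ : ℂ → E4) (hu₀s : ContDiff ℝ ∞ u₀)
    (hu₀J : IsJHolomorphicFlat J u₀) (Ψ : ℂ → (ℂ × ℂ) →L[ℝ] E4) (hΨs : ContDiff ℝ ∞ Ψ)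
    (hΨt : ∀ ξ (y₁ : ℂ), Ψ ξ (y₁, 0) = fderiv ℝ u₀ ξ y₁) (eQ : ℂ →L[ℝ] E4) (ξ : ℂ)
    (hloc : ∀ᶠ ξ' in 𝓝 ξ, ∀ y : ℂ × ℂ, Ψ ξ' y = fderiv ℝ u₀ ξ' y.1 + eQ y.2)
    (hJloc : J =ᶠ[𝓝 (u₀ ξ)] fun _ => J (u₀ ξ)) :
    fderiv ℝ Ψ ξ (1 : ℂ) + (J (u₀ ξ)).comp (fderiv ℝ Ψ ξ Complex.I) +
      (ContinuousLinearMap.apply ℝ E4 (fderiv ℝ u₀ ξ Complex.I)).comp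
        ((fderiv ℝ J (u₀ ξ)).comp (Ψ ξ)) = 0 := by
  have hdΨ : Differentiable ℝ Ψ := hΨs.differentiable (by simp)
  -- `DJ(u₀ ξ) = 0`
  have hDJ0 : fderiv ℝ J (u₀ ξ) = 0 := by
    rw [hJloc.fderiv_eq]
    exact fderiv_const_apply _
  -- the second column of the frame does not depend on `ξ'` near `ξ`
  have hcol2 : ∀ (v y₂ : ℂ), fderiv ℝ Ψ ξ v (0, y₂) = 0 := by
    intro v y₂
    have hev : (fun ξ' => Ψ ξ' ((0 : ℂ), y₂)) =ᶠ[𝓝 ξ] fun _ => eQ y₂ := by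
      filter_upwards [hloc] with ξ' hξ'
      rw [hξ']
      simp
    rw [fderiv_apply_const (hdΨ ξ), hev.fderiv_eq, fderiv_const_apply]
    rfl
  refine ContinuousLinearMap.ext fun y => ?_
  obtain ⟨y₁, y₂⟩ := y
  have hsplit : ((y₁, y₂) : ℂ × ℂ) = (y₁, 0) + (0, y₂) := by simp
  rw [hsplit, map_add, innerCoeff_apply_tangent J hJs hJ2 u₀ hu₀s hu₀J Ψ hΨs hΨt ξ y₁, zero_add,
    innerCoeff_apply, hcol2, hcol2, hDJ0]
  simp

end LinearisationTriangular

open LinearisationTriangular in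
/-- **Registered helper `helper_linearisationTriangular`.** The zeroth-order coefficient
`S ξ = Ψinv ξ ∘ (∂ₓΨ(ξ) + J(u₀ ξ) ∘ ∂_yΨ(ξ) + (A ↦ A (∂_y u₀ ξ)) ∘ DJ(u₀ ξ) ∘ Ψ ξ)` of the
frame-conjugated linearised Cauchy–Riemann operator along a smooth flat-`J`-holomorphic `u₀`
(frame `Ψ` with tangent first column, standard far out) is `C^∞`, kills the tangent column
`(y₁, 0)` (upper triangularity), and vanishes for `‖ξ‖ ≥ ρ₁ + 1` (compact support). -/
theorem helper_linearisationTriangular (J : E4 → E4 →L[ℝ] E4) (R : ℝ) (P Q : E4 →L[ℝ] ℂ)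
    (eP eQ : ℂ →L[ℝ] E4) (hR : 0 < R) (hJs : ContDiff ℝ ∞ J) (hJ2 : ∀ x v, J x (J x v) = -v)
    (hPQ : IsCoordFrame P Q eP eQ)
    (hJP : ∀ x : E4, R ≤ ‖x‖ → ∀ v, P (J x v) = Complex.I * P v)
    (hJQ : ∀ x : E4, R ≤ ‖x‖ → ∀ v, Q (J x v) = Complex.I * Q v) (u₀ : ℂ → E4)
    (hu₀s : ContDiff ℝ ∞ u₀) (hu₀J : IsJHolomorphicFlat J u₀) (Ψ : ℂ → (ℂ × ℂ) →L[ℝ] E4)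
    (Ψinv : ℂ → E4 →L[ℝ] (ℂ × ℂ)) (ρ₁ : ℝ) (hΨs : ContDiff ℝ ∞ Ψ) (hΨinvs : ContDiff ℝ ∞ Ψinv)
    (hleft : ∀ ξ, (Ψinv ξ).comp (Ψ ξ) = ContinuousLinearMap.id ℝ (ℂ × ℂ))
    (hright : ∀ ξ, (Ψ ξ).comp (Ψinv ξ) = ContinuousLinearMap.id ℝ E4)
    (hΨJ : ∀ ξ (y : ℂ × ℂ), Ψ ξ (Complex.I • y) = J (u₀ ξ) (Ψ ξ y))
    (hΨt : ∀ ξ (y₁ : ℂ), Ψ ξ (y₁, 0) = fderiv ℝ u₀ ξ y₁)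
    (hΨfar : ∀ ξ, ρ₁ ≤ ‖ξ‖ → ∀ y : ℂ × ℂ, Ψ ξ y = fderiv ℝ u₀ ξ y.1 + eQ y.2)
    (hfar : ∀ ξ, ρ₁ ≤ ‖ξ‖ → R + 1 ≤ ‖P (u₀ ξ)‖) :
    ContDiff ℝ ∞ (fun ξ : ℂ => (Ψinv ξ).comp ((fderiv ℝ Ψ ξ (1 : ℂ)) +
      (J (u₀ ξ)).comp (fderiv ℝ Ψ ξ Complex.I) +
      (ContinuousLinearMap.apply ℝ E4 (fderiv ℝ u₀ ξ Complex.I)).comp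
        ((fderiv ℝ J (u₀ ξ)).comp (Ψ ξ)))) ∧
    (∀ ξ (y₁ : ℂ), (Ψinv ξ).comp ((fderiv ℝ Ψ ξ (1 : ℂ)) +
      (J (u₀ ξ)).comp (fderiv ℝ Ψ ξ Complex.I) +
      (ContinuousLinearMap.apply ℝ E4 (fderiv ℝ u₀ ξ Complex.I)).comp
        ((fderiv ℝ J (u₀ ξ)).comp (Ψ ξ))) (y₁, 0) = 0) ∧
    (∀ ξ, ρ₁ + 1 ≤ ‖ξ‖ → (Ψinv ξ).comp ((fderiv ℝ Ψ ξ (1 : ℂ)) +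
      (J (u₀ ξ)).comp (fderiv ℝ Ψ ξ Complex.I) +
      (ContinuousLinearMap.apply ℝ E4 (fderiv ℝ u₀ ξ Complex.I)).comp
        ((fderiv ℝ J (u₀ ξ)).comp (Ψ ξ))) = 0) := by
  have _ := hR
  have _ := hleft
  have _ := hright
  have _ := hΨJ
  refine ⟨hΨinvs.clm_comp (contDiff_innerCoeff J hJs u₀ hu₀s Ψ hΨs), fun ξ y₁ => ?_,
    fun ξ hξ => ?_⟩
  · -- upper triangularity
    rw [ContinuousLinearMap.comp_apply,
      innerCoeff_apply_tangent J hJs hJ2 u₀ hu₀s hu₀J Ψ hΨs hΨt ξ y₁, map_zero]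
  · -- compact support: far out the frame is standard near `ξ` and `J` is constant near `u₀ ξ`
    have hξ' : ρ₁ < ‖ξ‖ := by linarith
    have hloc : ∀ᶠ ξ' in 𝓝 ξ, ∀ y : ℂ × ℂ, Ψ ξ' y = fderiv ℝ u₀ ξ' y.1 + eQ y.2 := by
      filter_upwards [(isOpen_lt continuous_const continuous_norm).mem_nhds hξ'] with ξ' h
      exact hΨfar ξ' (le_of_lt h)
    have hx₀ : R < ‖u₀ ξ‖ := by
      have h1 := hfar ξ hξ'.le
      have h2 := PencilDefs.norm_P_le hPQ (u₀ ξ)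
      linarith
    have hJloc : J =ᶠ[𝓝 (u₀ ξ)] fun _ => J (u₀ ξ) := by
      filter_upwards [(isOpen_lt continuous_const continuous_norm).mem_nhds hx₀] with x hx
      refine ContinuousLinearMap.ext fun v => PencilDefs.eq_of_apply_eq hPQ ?_ ?_
      · rw [hJP x (le_of_lt hx) v, hJP (u₀ ξ) hx₀.le v]
      · rw [hJQ x (le_of_lt hx) v, hJQ (u₀ ξ) hx₀.le v]
    rw [innerCoeff_eq_zero_of J hJs hJ2 u₀ hu₀s hu₀J Ψ hΨs hΨt eQ ξ hloc hJloc,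
      ContinuousLinearMap.comp_zero]

end Summit.SmoothPoincare4.SmoothPoincare4.Cruxes.TameOrBrodyR4.Sketch
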